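import Summits.KontsevichZagierPeriods.Zeta5Search.WedgeDictionaryFaceRelation
import HarnessLib

/-!
# Abel's lemma for the Casoratian `M₃` along a face direction (cell `pub-zeta5`)

HONEST FRAMING: systematic search; no irrationality claim unless certified.

OUR work (Summit side; lead/literature seat generation 4, 2026-08-20). Second of three files on CF-M3 on the
face `{b₇ = 0}` (`WedgeDictionaryFaceRelation` → this → `WedgeDictionaryFace`).

* **Coefficient relation of a summable combination** (`coeff_rel_of_summable`, the linear-functional form of
  gen-1 g4's summability principle behind `rank_two`): if `c₁·numPoly b₁ + c₂·numPoly b₂ + c₃·numPoly b₃ =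
  g(X+1)X⁶ − g·(X+N)⁶` with `deg g < 6N` at a common level `N`, then `Σ cᵢ U(bᵢ) = 0 = Σ cᵢ W(bᵢ)`
  (partial fractions of the telescoping sum vanish order by order, `pf_unique`).
* **Abel's lemma** (`quadM3_face_step`): for `b` on the face, `d(b) ≥ 1`, direction `j ≤ 6` with `b_j + 1 ≤ N`:
  `d(b)·M₃(b+e_j) = γ₀(b,j)·M₃(b)` — the Casoratian of two solutions (`U`, `W`) of the three-term relation
  `face_threeTerm` is multiplicative along the direction (the mechanism behind the closed-form Casorati
  determinants of very-well-poised contiguous solutions in print: Gupta–Masson, Trans. AMS 350 (1998) §7).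
-/

noncomputable section

open Finset Polynomial

namespace Summit.KontsevichZagierPeriods.Zeta5Search.WedgeDictionary

open Summit.KontsevichZagierPeriods.Zeta5Search.DualSeries
open Literature.NumberTheory.Transcendental
open Literature.NumberTheory.Transcendental.BallRivoal (pfEval pf_unique poch_pos pochPoly eval_pochPoly pfEval_sub'
  pfEval_const_mul pfEval_add)
open Literature.NumberTheory.Irrationality.CressonFischlerRivoal2008 (exists_pf_data)

/-! ### Summable combinations have vanishing coefficient sums -/

/-- Telescoping of a summable numerator (the general form of `polyNum_telescope`): if
`P = g(X+1)·X⁶ − g·(X+N)⁶` and `γ` are partial-fraction data of `G(t) = g(t+1)/((t+1)_N)⁶` (`N ≥ 1`), then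
`P(t+1)/((t+1)_{N+1})⁶ = G(t+1) − G(t)` at every natural `t`. -/
theorem telescope_eval {N : ℕ} (hN : 1 ≤ N) {P g : ℚ[X]}
    (hP : P = g.comp (X + C 1) * X ^ 6 - g * (X + C (N : ℚ)) ^ 6) {γ : ℕ → ℕ → ℚ}
    (hγ : ∀ t : ℚ, (∀ p, p ≤ N - 1 → t + p + 1 ≠ 0) →
      pfEval (N - 1) 6 γ t = (g.comp (X + C 1)).eval t / BallRivoal.poch (t + 1) N ^ 6) (t : ℕ) :
    (P.comp (X + C 1)).eval (t : ℚ) / BallRivoal.poch ((t : ℚ) + 1) (N + 1) ^ 6 =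
      pfEval (N - 1) 6 γ ((t : ℚ) + 1) - pfEval (N - 1) 6 γ t := by
  rw [hγ _ (fun p _ => by positivity), hγ _ (fun p _ => by positivity), hP]
  simp only [eval_comp, eval_sub, eval_mul, eval_pow, eval_add, eval_X, eval_C]
  obtain ⟨M, rfl⟩ : ∃ M, N = M + 1 := ⟨N - 1, by omega⟩
  have e1 : BallRivoal.poch ((t : ℚ) + 1) (M + 1 + 1) =
      BallRivoal.poch ((t : ℚ) + 1) (M + 1) * ((t : ℚ) + 1 + (M + 1 : ℕ)) := poch_succ_right _ _
  have e2 : BallRivoal.poch ((t : ℚ) + 1) (M + 1 + 1) = ((t : ℚ) + 1) * BallRivoal.poch ((t : ℚ) + 1 + 1) (M + 1) :=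
    poch_succ_left _ _
  have hP0 : BallRivoal.poch ((t : ℚ) + 1) (M + 1) ≠ 0 := (poch_pos (by positivity) _).ne'
  have hP1 : BallRivoal.poch ((t : ℚ) + 1 + 1) (M + 1) ≠ 0 := (poch_pos (by positivity) _).ne'
  have ht1 : ((t : ℚ) + 1) ≠ 0 := by positivity
  have e2' : BallRivoal.poch ((t : ℚ) + 1 + 1) (M + 1) = BallRivoal.poch ((t : ℚ) + 1) (M + 1 + 1) / ((t : ℚ) + 1) := by
    rw [e2, mul_div_cancel_left₀ _ ht1]
  rw [e2', e1]
  push_cast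
  field_simp

/-- **Coefficient relation of a summable combination** (the linear-functional form of gen-1 g4's summability
principle). If `b₁, b₂, b₃` lie in the box at a common level `N ≥ 1` with `Σ_j b_j ≤ 3N + 1`, and
`c₁·numPoly b₁ + c₂·numPoly b₂ + c₃·numPoly b₃ = g(X+1)X⁶ − g(X+N)⁶` with `deg g < 6N`, then
`c₁U(b₁) + c₂U(b₂) + c₃U(b₃) = 0` and `c₁W(b₁) + c₂W(b₂) + c₃W(b₃) = 0`. -/
theorem coeff_rel_of_summable (b₁ b₂ b₃ : ℕ → ℤ) (N : ℕ) (hN : 1 ≤ N)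
    (h₁ : InBox b₁) (h₂ : InBox b₂) (h₃ : InBox b₃)
    (hs₁ : ∑ j ∈ range 7, b₁ (j + 1) ≤ 3 * b₁ 0 + 1) (hs₂ : ∑ j ∈ range 7, b₂ (j + 1) ≤ 3 * b₂ 0 + 1)
    (hs₃ : ∑ j ∈ range 7, b₃ (j + 1) ≤ 3 * b₃ 0 + 1)
    (hN₁ : (b₁ 0).toNat = N) (hN₂ : (b₂ 0).toNat = N) (hN₃ : (b₃ 0).toNat = N)
    (c₁ c₂ c₃ : ℚ) (g : ℚ[X]) (hg : g.natDegree + 1 ≤ 6 * N)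
    (hrel : C c₁ * numPoly b₁ + C c₂ * numPoly b₂ + C c₃ * numPoly b₃ =
      g.comp (X + C 1) * X ^ 6 - g * (X + C (N : ℚ)) ^ 6) :
    c₁ * coeffU b₁ + c₂ * coeffU b₂ + c₃ * coeffU b₃ = 0 ∧
      c₁ * coeffW b₁ + c₂ * coeffW b₂ + c₃ * coeffW b₃ = 0 := by
  obtain ⟨d₁, hd₁⟩ := exists_isPFData b₁ h₁ hs₁
  obtain ⟨d₂, hd₂⟩ := exists_isPFData b₂ h₂ hs₂
  obtain ⟨d₃, hd₃⟩ := exists_isPFData b₃ h₃ hs₃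
  obtain ⟨γ, hγ⟩ := exists_pf_summable hN hg
  set e : ℕ → ℕ → ℚ := fun o p =>
    c₁ * d₁ o p + c₂ * d₂ o p + c₃ * d₃ o p + padData (N - 1) γ o p - shiftUp γ o p with he
  have he0 : ∀ t : ℕ, pfEval N 6 e t = 0 := by
    intro t
    have ht : ∀ p, p ≤ N → (t : ℚ) + p + 1 ≠ 0 := fun p _ => by positivity
    have E1 := hd₁ t (by rw [hN₁]; exact ht)
    have E2 := hd₂ t (by rw [hN₂]; exact ht)
    have E3 := hd₃ t (by rw [hN₃]; exact ht)
    rw [hN₁] at E1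
    rw [hN₂] at E2
    rw [hN₃] at E3
    have Esh : pfEval N 6 (shiftUp γ) t = pfEval (N - 1) 6 γ ((t : ℚ) + 1) := by
      rw [show N = (N - 1) + 1 from by omega, pfEval_shiftUp, show N - 1 + 1 - 1 = N - 1 by omega]
    have Epad : pfEval N 6 (padData (N - 1) γ) t = pfEval (N - 1) 6 γ t := pfEval_padData (by omega) _ _ _
    have Etel := telescope_eval hN hrel hγ t
    rw [he, pfEval_comb, E1, E2, E3, Esh, Epad]
    simp only [eval_comp, eval_add, eval_mul, eval_C, eval_X] at Etel ⊢
    linear_combination Etel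
  have hz : ∀ {o : ℕ}, o < 6 → ∑ p ∈ range (N + 1), e o p = 0 := fun ho =>
    sum_eq_zero_of_pfEval_zero N 6 e he0 ho
  have htel : ∀ o, ∑ p ∈ range (N + 1), (padData (N - 1) γ o p - shiftUp γ o p) = 0 := by
    intro o
    rw [sum_sub_distrib, show N + 1 = (N - 1) + 2 by omega, sum_shiftUp,
      show N - 1 + 2 = (N - 1 + 1) + 1 by omega, sum_padData (by omega), sub_self]
  have hexp : ∀ o, ∑ p ∈ range (N + 1), e o p =
      c₁ * ∑ p ∈ range (N + 1), d₁ o p + c₂ * ∑ p ∈ range (N + 1), d₂ o p + c₃ * ∑ p ∈ range (N + 1), d₃ o p := by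
    intro o
    calc ∑ p ∈ range (N + 1), e o p
        = ∑ p ∈ range (N + 1), (c₁ * d₁ o p + c₂ * d₂ o p + c₃ * d₃ o p) +
            ∑ p ∈ range (N + 1), (padData (N - 1) γ o p - shiftUp γ o p) := by
          rw [← sum_add_distrib]
          exact sum_congr rfl fun p _ => by simp only [he]; ring
      _ = _ := by rw [htel, add_zero, sum_add_distrib, sum_add_distrib, ← mul_sum, ← mul_sum, ← mul_sum]
  refine ⟨?_, ?_⟩
  · have h := hz (show 4 < 6 by norm_num)
    rw [hexp] at h
    rw [coeffU_eq hd₁, coeffU_eq hd₂, coeffU_eq hd₃, hN₁, hN₂, hN₃]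
    linear_combination h
  · have h := hz (show 2 < 6 by norm_num)
    rw [hexp] at h
    rw [coeffW_eq hd₁, coeffW_eq hd₂, coeffW_eq hd₃, hN₁, hN₂, hN₃]
    linear_combination h

/-! ### Abel's lemma: the Casoratian along a coordinate direction -/

/-- `d(b + e_{i+1}) = d(b) − 1`. -/
theorem dOf_bump (b : ℕ → ℤ) {i : ℕ} (hi : i ∈ range 7) : dOf (bump b i) = dOf b - 1 := by
  unfold dOf bump
  rw [sum_update b hi, Function.update_of_ne (show (0 : ℕ) ≠ i + 1 by omega)]
  ring

/-- `deg h_b ≤ 2 Σ_j b_j`. -/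
theorem natDegree_hPoly_le (b : ℕ → ℤ) : (hPoly b).natDegree ≤ ∑ j ∈ range 7, 2 * (b (j + 1)).toNat := by
  unfold hPoly
  refine (natDegree_prod_le _ _).trans (sum_le_sum fun j _ => ?_)
  refine natDegree_mul_le.trans ?_
  have e1 := natDegree_pochPoly_le 0 (b (j + 1)).toNat
  have e2 := natDegree_pochPoly_le ((b 0 - b (j + 1) : ℤ) : ℚ) (b (j + 1)).toNat
  omega

/-- The degree bound `deg(−h_b) + 1 ≤ 6N` as soon as `d(b) ≥ 1`. -/
theorem natDegree_neg_hPoly_succ_le (b : ℕ → ℤ) (hb : InBox b) (hd : 1 ≤ dOf b) :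
    (-hPoly b).natDegree + 1 ≤ 6 * (b 0).toNat := by
  rw [natDegree_neg]
  have h1 := natDegree_hPoly_le b
  obtain ⟨h0, hj⟩ := hb
  have hb0 : (b 0 : ℤ) = ((b 0).toNat : ℤ) := (Int.toNat_of_nonneg h0).symm
  have hS : ∑ j ∈ range 7, b (j + 1) = ((∑ j ∈ range 7, (b (j + 1)).toNat : ℕ) : ℤ) := by
    rw [Nat.cast_sum]
    exact sum_congr rfl fun j hj' => (Int.toNat_of_nonneg (hj j hj').1).symm
  have h2 : ∑ j ∈ range 7, 2 * (b (j + 1)).toNat = 2 * ∑ j ∈ range 7, (b (j + 1)).toNat := by rw [mul_sum]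
  unfold dOf at hd
  rw [hS, hb0] at hd
  omega

/-- **Abel's lemma on the face.** For `b` in the box with `b₇ = 0`, `d(b) ≥ 1`, a direction `i < 6` with
`b_{i+1} + 1 ≤ N` (and all `b_j ≤ N`): `d(b)·M₃(b + e_{i+1}) = γ₀(b,i)·M₃(b)`. -/
theorem quadM3_face_step (b : ℕ → ℤ) (hb : InBox b) (h7 : b 7 = 0) (hd : 1 ≤ dOf b) {i : ℕ} (hi : i ∈ range 6)
    (hbi : b (i + 1) + 1 ≤ b 0) :
    (dOf b : ℚ) * quadM3 (bump b i) = faceGamma0 b i * quadM3 b := by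
  have hi7 : i ∈ range 7 := by have := mem_range.1 hi; exact mem_range.2 (by omega)
  have hd0 : 0 ≤ dOf b := by omega
  have hle : b (i + 1) ≤ b 0 := by omega
  have hβ0 : 0 ≤ b (i + 1) := (hb.2 i hi7).1
  have hNz : ((b 0).toNat : ℤ) = b 0 := Int.toNat_of_nonneg hb.1
  have hN : 1 ≤ (b 0).toNat := by omega
  -- the three points b, b' = b + e, b'' = b + 2e
  obtain ⟨hb', hs'⟩ := box_update b hb hd0 hi7 hle
  change InBox (bump b i) at hb'
  change ∑ l ∈ range 7, bump b i (l + 1) ≤ 3 * bump b i 0 + 1 at hs'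
  have hd0' : 0 ≤ dOf (bump b i) := by rw [dOf_bump b hi7]; omega
  have hle' : bump b i (i + 1) ≤ bump b i 0 := by rw [bump_self, bump_zero]; exact hbi
  obtain ⟨hb'', hs''⟩ := box_update (bump b i) hb' hd0' hi7 hle'
  change InBox (bump (bump b i) i) at hb''
  change ∑ l ∈ range 7, bump (bump b i) i (l + 1) ≤ 3 * bump (bump b i) i 0 + 1 at hs''
  have hs : ∑ j ∈ range 7, b (j + 1) ≤ 3 * b 0 + 1 := sum_le_of_dOf b hd0
  -- the coefficient relations
  obtain ⟨hU, hW⟩ := coeff_rel_of_summable (bump (bump b i) i) (bump b i) b (b 0).toNat hN hb'' hb' hb hs'' hs' hs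
    (by rw [bump_zero, bump_zero]) (by rw [bump_zero]) rfl (dOf b : ℚ) (faceGamma1 b i) (faceGamma0 b i) (-hPoly b)
    (natDegree_neg_hPoly_succ_le b hb hd) (face_threeTerm b hb h7 hi)
  -- the two Casoratians
  have hq : coeffU b * coeffW (bump b i) - coeffU (bump b i) * coeffW b = quadM3 b :=
    wedgeQ_eq_quadM3 b hb hd0 hi7 hle
  have hq' : coeffU (bump b i) * coeffW (bump (bump b i) i) - coeffU (bump (bump b i) i) * coeffW (bump b i) =
      quadM3 (bump b i) :=
    wedgeQ_eq_quadM3 (bump b i) hb' hd0' hi7 hle'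
  linear_combination (-(dOf b : ℚ)) * hq' + faceGamma0 b i * hq + coeffU (bump b i) * hW - coeffW (bump b i) * hU

end Summit.KontsevichZagierPeriods.Zeta5Search.WedgeDictionary
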